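import Literature.Computability.Cryptography.WordRAMStructured
import HarnessLib

/-!
# The word RAM — straight-line blocks and a total-correctness logic for structured code

A thin verification layer over the big-step semantics `SProg.Exec` / `SProg.ExecLE` of
`Literature.Computability.Cryptography.WordRAMStructured` (Nipkow–Klein, *Concrete Semantics*,
§7, §12), in the form used to verify the instance-building programs of reductions:

* `SProg.block ops`: a straight-line block of three-address operations (`OpSpec` of
  `…WordRAMBlocks`) as structured code, executing in exactly `|ops|` steps to `execOps W mem ops`
  (`SProg.Exec.block`), so that straight-line code is verified by symbolic evaluation of the pure
  function `execOps`; `SProg.seqs` (a list of programs in sequence);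
* `SProg.Achieves W O s mem Q T`: *total correctness with a time bound from one start memory* —
  for every query log, `s` executes from `⟨mem, ·⟩` within `T` steps, leaving the query log
  unchanged, to a memory satisfying `Q` (a Hoare triple `{· = mem} s {Q}` with termination and
  cost, Nipkow–Klein §12.2, specialised to query-free use);
* its rules: consequence/monotonicity (`Achieves.mono`), `skip`, `block`, `op`, sequencing
  (`seq`, `seqs_nil`, `seqs_cons`), the conditional (`ifz_zero`, `ifz_ne`), and the counted
  **while rule with invariant and time bound** (`Achieves.whilenz`, from
  `ExecLE.whilenz_invariant`: `N` iterations of a `K`-bounded body cost `N (K + 2) + 1`);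
* `Achieves.exists_exec`: extraction of an `Exec` certificate from the empty query log, the form
  consumed by `SProg.haltsWithin_toProgram` / `outputsWithin_toProgram`.

## References

* T. Nipkow, G. Klein, *Concrete Semantics with Isabelle/HOL*, Springer 2014, §7.2, §12.2
  (Hoare logic, total correctness with a variant).
* V. Vassilevska Williams, *On some fine-grained questions in algorithms and complexity*,
  Proc. ICM 2018, §2 (the machine model).
-/

namespace Literature.Computability.Cryptography.WordRAM.SProg

open StateTransition

variable {W : ℕ} {O : List ℕ → List ℕ}

/-! ## Straight-line blocks and sequences -/

/-- A straight-line block of operations as structured code. [folklore] -/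
def block : List OpSpec → SProg
  | [] => skip
  | s :: ops => seq (op s.1 s.2.1 s.2.2.1 s.2.2.2) (block ops)

/-- A list of programs in sequence. [folklore] -/
def seqs : List SProg → SProg
  | [] => skip
  | s :: l => seq s (seqs l)

/-- Blocks are query-free. [folklore] -/
theorem block_queryFree : ∀ ops : List OpSpec, (block ops).QueryFree
  | [] => trivial
  | _ :: ops => ⟨trivial, block_queryFree ops⟩

/-- A sequence of query-free programs is query-free. [folklore] -/
theorem seqs_queryFree : ∀ {l : List SProg}, (∀ s ∈ l, s.QueryFree) → (seqs l).QueryFree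
  | [], _ => trivial
  | s :: l, h => ⟨h s (by simp), seqs_queryFree fun u hu => h u (by simp [hu])⟩

/-- The code of a block has one instruction per operation. [folklore] -/
@[simp] theorem len_block : ∀ ops : List OpSpec, (block ops).len = ops.length
  | [] => rfl
  | _ :: ops => by simp [block, len, len_block ops, Nat.add_comm]

/-- The code length of a sequence is the sum of the lengths. [folklore] -/
@[simp] theorem len_seqs : ∀ l : List SProg, (seqs l).len = (l.map len).sum
  | [] => rfl
  | s :: l => by simp [seqs, len, len_seqs l]

/-- **Straight-line execution**: a block runs in exactly `|ops|` steps to `execOps W mem ops`,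
query log unchanged. [folklore] -/
theorem Exec.block : ∀ (ops : List OpSpec) (mem : ℕ → ℕ) (qs : List (List ℕ)),
    Exec W O (block ops) ⟨mem, qs⟩ ⟨execOps W mem ops, qs⟩ ops.length
  | [], mem, qs => Exec.skip _
  | s :: ops, mem, qs => by
    rw [List.length_cons, Nat.add_comm]
    exact Exec.seq (Exec.op s.1 s.2.1 s.2.2.1 s.2.2.2 ⟨mem, qs⟩) (Exec.block ops _ qs)

/-! ## Total correctness with a time bound -/

/-- `Achieves W O s mem Q T`: from memory `mem` (any query log), the structured code `s` executes
within `T` steps, without changing the query log, to a memory satisfying `Q`. [folklore] -/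
def Achieves (W : ℕ) (O : List ℕ → List ℕ) (s : SProg) (mem : ℕ → ℕ) (Q : (ℕ → ℕ) → Prop)
    (T : ℕ) : Prop :=
  ∀ qs : List (List ℕ), ∃ (mem' : ℕ → ℕ) (t : ℕ), t ≤ T ∧ Exec W O s ⟨mem, qs⟩ ⟨mem', qs⟩ t ∧ Q mem'

namespace Achieves

variable {s u : SProg} {mem : ℕ → ℕ} {Q R : (ℕ → ℕ) → Prop} {T T₁ T₂ : ℕ}

/-- Consequence and time weakening. [folklore] -/
theorem mono (h : Achieves W O s mem Q T) {Q' : (ℕ → ℕ) → Prop} {T' : ℕ} (hQ : ∀ m, Q m → Q' m)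
    (hT : T ≤ T') : Achieves W O s mem Q' T' := fun qs => by
  obtain ⟨m', t, ht, hex, hq⟩ := h qs
  exact ⟨m', t, ht.trans hT, hex, hQ m' hq⟩

/-- Extraction of an execution certificate from the empty query log. [folklore] -/
theorem exists_exec (h : Achieves W O s mem Q T) :
    ∃ (st : Store) (t : ℕ), t ≤ T ∧ Exec W O s ⟨mem, []⟩ st t ∧ Q st.mem ∧ st.queries = [] := by
  obtain ⟨m', t, ht, hex, hq⟩ := h []
  exact ⟨⟨m', []⟩, t, ht, hex, hq, rfl⟩

/-- `skip` achieves what holds already, in no time. [folklore] -/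
theorem skip (h : Q mem) : Achieves W O skip mem Q T := fun _ =>
  ⟨mem, 0, Nat.zero_le _, Exec.skip _, h⟩

/-- **The block rule**: a straight-line block achieves, in `|ops|` steps, whatever holds of
`execOps W mem ops`. [folklore] -/
theorem block {ops : List OpSpec} (h : Q (execOps W mem ops)) (hT : ops.length ≤ T) :
    Achieves W O (block ops) mem Q T := fun qs =>
  ⟨_, _, hT, Exec.block ops mem qs, h⟩

/-- One operation. [folklore] -/
theorem op {o : BinOp} {d x y : Operand}
    (h : Q (d.write mem (o.eval W (x.read mem) (y.read mem)))) (hT : 1 ≤ T) :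
    Achieves W O (op o d x y) mem Q T := fun qs =>
  ⟨_, 1, hT, Exec.op o d x y ⟨mem, qs⟩, h⟩

/-- **Sequencing** through an intermediate assertion. [folklore] -/
theorem seq (h₁ : Achieves W O s mem R T₁) (h₂ : ∀ m, R m → Achieves W O u m Q T₂) :
    Achieves W O (seq s u) mem Q (T₁ + T₂) := fun qs => by
  obtain ⟨m₁, t₁, ht₁, hex₁, hr⟩ := h₁ qs
  obtain ⟨m₂, t₂, ht₂, hex₂, hq⟩ := h₂ m₁ hr qs
  exact ⟨m₂, t₁ + t₂, Nat.add_le_add ht₁ ht₂, Exec.seq hex₁ hex₂, hq⟩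

/-- The empty sequence. [folklore] -/
theorem seqs_nil (h : Q mem) : Achieves W O (seqs []) mem Q T := skip h

/-- A nonempty sequence, through an intermediate assertion. [folklore] -/
theorem seqs_cons {l : List SProg} (h₁ : Achieves W O s mem R T₁)
    (h₂ : ∀ m, R m → Achieves W O (seqs l) m Q T₂) : Achieves W O (seqs (s :: l)) mem Q (T₁ + T₂) :=
  seq h₁ h₂

/-- The conditional, zero case. [folklore] -/
theorem ifz_zero {x : Operand} (hx : x.read mem = 0) (h : Achieves W O s mem Q T) :
    Achieves W O (ifz x s u) mem Q (T + 2) := fun qs => by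
  obtain ⟨m', t, ht, hex, hq⟩ := h qs
  exact ⟨m', t + 1, by omega, Exec.ifz_zero hx hex, hq⟩

/-- The conditional, nonzero case. [folklore] -/
theorem ifz_ne {x : Operand} (hx : x.read mem ≠ 0) (h : Achieves W O u mem Q T) :
    Achieves W O (ifz x s u) mem Q (T + 2) := fun qs => by
  obtain ⟨m', t, ht, hex, hq⟩ := h qs
  exact ⟨m', t + 2, by omega, Exec.ifz_ne hx hex, hq⟩

/-- The conditional by cases on the test, with a common bound. [folklore] -/
theorem ifz {x : Operand} (h0 : x.read mem = 0 → Achieves W O s mem Q T)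
    (h1 : x.read mem ≠ 0 → Achieves W O u mem Q T) : Achieves W O (ifz x s u) mem Q (T + 2) := by
  by_cases hx : x.read mem = 0
  exacts [ifz_zero hx (h0 hx), ifz_ne hx (h1 hx)]

/-- **The while rule** (total correctness with an iteration count): if from every memory
satisfying `Inv i` (`i < N`) the test operand reads nonzero and the body achieves `Inv (i + 1)`
within `K` steps, and `Inv N` forces the test to read `0`, then from `Inv 0` the loop achieves
every consequence of `Inv N` within `N (K + 2) + 1` steps. [folklore] -/
theorem whilenz {x : Operand} {body : SProg} (N K : ℕ) (Inv : ℕ → (ℕ → ℕ) → Prop)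
    (hbody : ∀ i, i < N → ∀ m, Inv i m → x.read m ≠ 0 ∧ Achieves W O body m (Inv (i + 1)) K)
    (hexit : ∀ m, Inv N m → x.read m = 0) (h0 : Inv 0 mem) (hQ : ∀ m, Inv N m → Q m)
    (hT : N * (K + 2) + 1 ≤ T) : Achieves W O (whilenz x body) mem Q T := fun qs => by
  obtain ⟨st', ⟨t, ht, hex⟩, hinv, hqs⟩ := ExecLE.whilenz_invariant (w := W) (O := O) (x := x)
    (s := body) N K (fun i st => Inv i st.mem ∧ st.queries = qs)
    (fun i hi st ⟨hst, hq⟩ => by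
      obtain ⟨hne, hach⟩ := hbody i hi st.mem hst
      obtain ⟨m', t, ht, hex, hm'⟩ := hach st.queries
      refine ⟨hne, ⟨m', st.queries⟩, ⟨t, ht, ?_⟩, hm', hq⟩
      cases st; exact hex)
    (fun st ⟨hst, _⟩ => hexit st.mem hst) (st := ⟨mem, qs⟩) ⟨h0, rfl⟩
  cases st'
  simp only at hqs hinv
  subst hqs
  exact ⟨_, t, ht.trans hT, hex, hQ _ hinv⟩

end Achieves

end Literature.Computability.Cryptography.WordRAM.SProg
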